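import Literature.NumberTheory.LFunctions.KloostermanFractionsC1
import Literature.NumberTheory.LFunctions.KloostermanFractionsParams
import HarnessLib

/-!
# Bilinear forms with Kloosterman fractions: the explicit bound for `𝓒_b` in the main regime

We instantiate `kfCb_le` with the amplifying primes `𝓛 = {L < ℓ ≤ 2L : (ℓ, bk) = 1}`
(`KloostermanFractionsParams`), `P = L/(4 log L)`, `M₁ = ⌊M⌋`, `M₂ = ⌊2M⌋`, `N' = N/b`, and
simplify the result to a sum of nine explicit terms (B–C §5 (rve) with `A = 1`, before the
choice of `L`):

  `𝓒_b ≤ ‖γ_b‖² · 32 M (log L)²/L² · ( 2LM + R (8T'M/N + 16T'²L(LN)^{1/2}(1+log 4LN))`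
  `      + T' ( 2LN(1+4R)/b + T'LM + 8L^{3/2}N/b^{1/2} + 32^{1/2}L²N/(bM)^{1/2}`
  `      + 237 T'L³N^{3/2}F₀^{1/2}/(bM) + 79 T'L³N^{3/2}F₀^{1/2}/(bM) (T'L(8N/b)^{1/2})^{1/2}(1+log 8L²N)^{1/2} ) )`,

`R = log 2N/log L`, `F₀ = 1 + 64π|k|/(MN)`.

## References
* S. Bettin, V. Chandee, Adv. Math. 328 (2018), arXiv:1502.00769, §5 (rve). [cite: BettinChandee2018, §5]
* W. Duke, J. Friedlander, H. Iwaniec, Invent. Math. 128 (1997) 23–43, §5.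
  [cite: DukeFriedlanderIwaniec1997, §5]
-/

noncomputable section

open Finset

namespace Literature.NumberTheory.LFunctions

/-- `√(a + b) ≤ √a + √b`. [folklore] -/
theorem kfm_sqrt_add_le {a b : ℝ} (ha : 0 ≤ a) (hb : 0 ≤ b) :
    Real.sqrt (a + b) ≤ Real.sqrt a + Real.sqrt b := by
  rw [Real.sqrt_le_left (by positivity)]
  have h1 := Real.sq_sqrt ha
  have h2 := Real.sq_sqrt hb
  nlinarith [Real.sqrt_nonneg a, Real.sqrt_nonneg b]

/-- The square root of the off-diagonal quantity `L b Θ`, simplified: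
`(LbΘ)^{1/2} ≤ 8L^{3/2}N/b^{1/2} + 32^{1/2}L²N/(bM)^{1/2} + 79T'L³N^{3/2}F₀^{1/2}(3 + Q^{1/2})/(bM)`
when `Dg ≤ 2M/L + 1`, `M ≤ M⁺`, `F ≤ F₀`, `C ≤ 9 + Q`. [folklore] -/
theorem kfm_sqrt_theta_le {L b N M T' F C F₀ Q Dg Mp : ℝ} (hL : 0 < L) (hb : 0 < b) (hN : 0 < N)
    (hM : 0 < M) (hT' : 0 ≤ T') (hF0 : 0 ≤ F) (hC0 : 0 ≤ C) (hQ : 0 ≤ Q)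
    (hDg : Dg ≤ 2 * M / L + 1) (hMp : M ≤ Mp) (hF : F ≤ F₀) (hC : C ≤ 9 + Q) :
    Real.sqrt (L * b * (L * (32 * L ^ 2 * (N / b) ^ 2 * Dg / Mp +
      6144 * T' ^ 2 * L ^ 4 * (N / b) ^ 3 * F * C / Mp ^ 2))) ≤
      8 * L * Real.sqrt L * N / Real.sqrt b + Real.sqrt 32 * L ^ 2 * N / (Real.sqrt b * Real.sqrt M) +
        79 * T' * L ^ 3 * N * Real.sqrt N * Real.sqrt F₀ * (3 + Real.sqrt Q) / (b * M) := by
  have hMp0 : 0 < Mp := hM.trans_le hMp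
  have hF₀0 : 0 ≤ F₀ := hF0.trans hF
  -- Step 1: monotone simplification of the inside
  set X₁ : ℝ := 64 * L ^ 3 * N ^ 2 / b with hX₁
  set X₂ : ℝ := 32 * L ^ 4 * N ^ 2 / (b * M) with hX₂
  set X₃ : ℝ := 6144 * T' ^ 2 * L ^ 6 * N ^ 3 * F₀ * (9 + Q) / (b ^ 2 * M ^ 2) with hX₃
  have hin : L * b * (L * (32 * L ^ 2 * (N / b) ^ 2 * Dg / Mp +
      6144 * T' ^ 2 * L ^ 4 * (N / b) ^ 3 * F * C / Mp ^ 2)) ≤ X₁ + X₂ + X₃ := by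
    have h1 : 32 * L ^ 2 * (N / b) ^ 2 * Dg / Mp ≤ 32 * L ^ 2 * (N / b) ^ 2 * (2 * M / L + 1) / M := by
      refine div_le_div₀ (by positivity) (mul_le_mul_of_nonneg_left hDg (by positivity)) hM hMp
    have h2 : 6144 * T' ^ 2 * L ^ 4 * (N / b) ^ 3 * F * C / Mp ^ 2 ≤
        6144 * T' ^ 2 * L ^ 4 * (N / b) ^ 3 * F₀ * (9 + Q) / M ^ 2 := by
      refine div_le_div₀ (by positivity) ?_ (by positivity) (pow_le_pow_left₀ hM.le hMp 2)
      exact mul_le_mul (mul_le_mul_of_nonneg_left hF (by positivity)) hC hC0 (by positivity)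
    calc _ ≤ L * b * (L * (32 * L ^ 2 * (N / b) ^ 2 * (2 * M / L + 1) / M +
          6144 * T' ^ 2 * L ^ 4 * (N / b) ^ 3 * F₀ * (9 + Q) / M ^ 2)) :=
          mul_le_mul_of_nonneg_left (mul_le_mul_of_nonneg_left (add_le_add h1 h2) hL.le)
            (by positivity)
      _ = X₁ + X₂ + X₃ := by
          rw [hX₁, hX₂, hX₃]
          field_simp
          ring
  -- Step 2: square roots of the three pieces
  have hs₁ : Real.sqrt X₁ = 8 * L * Real.sqrt L * N / Real.sqrt b := by
    rw [hX₁, Real.sqrt_eq_iff_mul_self_eq (by positivity) (by positivity)]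
    have hL2 := Real.mul_self_sqrt hL.le
    have hb2 := Real.mul_self_sqrt hb.le
    have hb0 : Real.sqrt b ≠ 0 := (Real.sqrt_pos.mpr hb).ne'
    field_simp
    nlinarith [hL2, hb2]
  have hs₂ : Real.sqrt X₂ = Real.sqrt 32 * L ^ 2 * N / (Real.sqrt b * Real.sqrt M) := by
    rw [hX₂, Real.sqrt_eq_iff_mul_self_eq (by positivity) (by positivity)]
    have h32 := Real.mul_self_sqrt (show (0:ℝ) ≤ 32 by norm_num)
    have hb2 := Real.mul_self_sqrt hb.le
    have hM2 := Real.mul_self_sqrt hM.le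
    have hb0 : Real.sqrt b ≠ 0 := (Real.sqrt_pos.mpr hb).ne'
    have hM0 : Real.sqrt M ≠ 0 := (Real.sqrt_pos.mpr hM).ne'
    have e : Real.sqrt 32 * L ^ 2 * N / (Real.sqrt b * Real.sqrt M) *
        (Real.sqrt 32 * L ^ 2 * N / (Real.sqrt b * Real.sqrt M)) =
        (Real.sqrt 32 * Real.sqrt 32) * L ^ 4 * N ^ 2 /
          ((Real.sqrt b * Real.sqrt b) * (Real.sqrt M * Real.sqrt M)) := by
      field_simp
    rw [e, h32, hb2, hM2]
  have hs₃ : Real.sqrt X₃ ≤ 79 * T' * L ^ 3 * N * Real.sqrt N * Real.sqrt F₀ * (3 + Real.sqrt Q) /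
      (b * M) := by
    have h9Q : Real.sqrt (9 + Q) ≤ 3 + Real.sqrt Q := by
      have := kfm_sqrt_add_le (show (0:ℝ) ≤ 9 by norm_num) hQ
      rwa [show Real.sqrt 9 = 3 by rw [show (9:ℝ) = 3 ^ 2 by norm_num, Real.sqrt_sq (by norm_num)]] at this
    have hX₃' : X₃ = (Real.sqrt 6144 * T' * L ^ 3 * N * Real.sqrt N * Real.sqrt F₀ * Real.sqrt (9 + Q) /
        (b * M)) ^ 2 := by
      rw [hX₃, div_pow]
      have e1 : (Real.sqrt 6144 * T' * L ^ 3 * N * Real.sqrt N * Real.sqrt F₀ * Real.sqrt (9 + Q)) ^ 2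
          = 6144 * T' ^ 2 * L ^ 6 * N ^ 3 * F₀ * (9 + Q) := by
        rw [show (Real.sqrt 6144 * T' * L ^ 3 * N * Real.sqrt N * Real.sqrt F₀ * Real.sqrt (9 + Q)) ^ 2
          = (Real.sqrt 6144) ^ 2 * T' ^ 2 * (L ^ 3) ^ 2 * N ^ 2 * (Real.sqrt N) ^ 2 * (Real.sqrt F₀) ^ 2 *
            (Real.sqrt (9 + Q)) ^ 2 by ring]
        rw [Real.sq_sqrt (by norm_num), Real.sq_sqrt hN.le, Real.sq_sqrt hF₀0,
          Real.sq_sqrt (by positivity)]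
        ring
      rw [e1]
      ring
    rw [hX₃', Real.sqrt_sq (by positivity)]
    have h79 : Real.sqrt 6144 ≤ 79 := by
      rw [Real.sqrt_le_left (by norm_num)]; norm_num
    have hnum : Real.sqrt 6144 * T' * L ^ 3 * N * Real.sqrt N * Real.sqrt F₀ * Real.sqrt (9 + Q) ≤
        79 * T' * L ^ 3 * N * Real.sqrt N * Real.sqrt F₀ * (3 + Real.sqrt Q) :=
      mul_le_mul (mul_le_mul_of_nonneg_right (mul_le_mul_of_nonneg_right (mul_le_mul_of_nonneg_right
        (mul_le_mul_of_nonneg_right (mul_le_mul_of_nonneg_right h79 hT') (by positivity))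
        hN.le) (Real.sqrt_nonneg _)) (Real.sqrt_nonneg _)) h9Q (Real.sqrt_nonneg _) (by positivity)
    exact div_le_div_of_nonneg_right hnum (by positivity)
  -- combine
  calc _ ≤ Real.sqrt (X₁ + X₂ + X₃) := Real.sqrt_le_sqrt hin
    _ ≤ Real.sqrt X₁ + Real.sqrt X₂ + Real.sqrt X₃ := by
        have h1 := kfm_sqrt_add_le (show 0 ≤ X₁ + X₂ by positivity) (show 0 ≤ X₃ by positivity)
        have h2 := kfm_sqrt_add_le (show 0 ≤ X₁ by positivity) (show 0 ≤ X₂ by positivity)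
        linarith
    _ ≤ _ := by rw [hs₁, hs₂]; linarith [hs₃]

set_option maxHeartbeats 3000000 in
/-- **The explicit bound for `𝓒_b` in the main regime** (B–C (rve), `A = 1`, before choosing
`L`): for `b² ≤ N`, `M, N ≥ 1`, `(b, k) = 1`, `β` supported on `N < n ≤ 2N` coprime to `k`,
`L ≥ max(L₀, 2)` with `4(log b + log|k| + log⌊2M⌋) ≤ L`, and `T'` a divisor bound on
`[1, 16L²(N/b + ⌈4L(N/b)/(⌊M⌋+1)⌉) + 2N]`,
`𝓒_b(⌊M⌋,⌊2M⌋; N/b, γ_b) ≤ ‖γ_b‖² · BOUND(M,N,b,L,T',k)` (module docstring).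
[cite: BettinChandee2018, §5 (rve)] -/
theorem kfm_Cb_explicit (k : ℤ) (hk : k ≠ 0) {b : ℕ} (hb : 0 < b) (hkb : k.natAbs.Coprime b)
    (β : ℕ → ℂ) {M N : ℝ} (hM : 1 ≤ M) (hN : 1 ≤ N) (hbN : (b : ℝ) ^ 2 ≤ N)
    (hβ : ∀ n, β n ≠ 0 → N < n ∧ (n : ℝ) ≤ 2 * N ∧ n.Coprime k.natAbs)
    {L₀ : ℕ} (hL₀ : ∀ L : ℕ, L₀ ≤ L →
      (L : ℝ) / (2 * Real.log L) ≤ (((Finset.Ioc L (2 * L)).filter Nat.Prime).card : ℝ))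
    {L : ℕ} (hL : L₀ ≤ L) (hL2 : 2 ≤ L)
    (hΛ : 4 * (Real.log b + Real.log k.natAbs + Real.log ⌊2 * M⌋₊) ≤ L)
    {T' : ℝ} (hT' : ∀ w : ℕ, 1 ≤ w → (w : ℝ) ≤ 16 * (L : ℝ) ^ 2 *
      (N / b + (⌈4 * (L : ℝ) * (N / b) / ((⌊M⌋₊ : ℝ) + 1)⌉₊ : ℝ)) + 2 * b * (N / b) →
      (w.divisors.card : ℝ) ≤ T') :
    ∑ m ∈ (Ioc ⌊M⌋₊ ⌊2 * M⌋₊).filter (fun m => m.Coprime b),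
      ‖kfInner k b (N / b)
        (fun n' => if (Squarefree n' ∧ n'.Coprime b) then β (b * n') else 0) m‖ ^ 2 ≤
      (∑ n' ∈ Icc 1 ⌊2 * (N / b)⌋₊,
        ‖(if (Squarefree n' ∧ n'.Coprime b) then β (b * n') else 0)‖ ^ 2) *
      (32 * M * Real.log L ^ 2 / (L : ℝ) ^ 2 *
        (2 * L * M + Real.log (2 * N) / Real.log L *
          (8 * T' * M / N + 16 * T' ^ 2 * L * Real.sqrt (L * N) * (1 + Real.log (4 * (L * N)))) +
        T' * (2 * L * N * (1 + 4 * (Real.log (2 * N) / Real.log L)) / b + T' * L * M +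
          8 * L * Real.sqrt L * N / Real.sqrt b +
          Real.sqrt 32 * (L : ℝ) ^ 2 * N / (Real.sqrt b * Real.sqrt M) +
          79 * T' * (L : ℝ) ^ 3 * N * Real.sqrt N *
            Real.sqrt (1 + 64 * Real.pi * |(k : ℝ)| / (M * N)) *
            (3 + Real.sqrt (T' * L * Real.sqrt (8 * (N / b)) *
              (1 + Real.log (8 * (L : ℝ) ^ 2 * N)))) / (b * M)))) := by
  -- the amplifying primes and `P`
  set 𝓛 := (Ioc L (2 * L)).filter (fun ℓ => ℓ.Prime ∧ ℓ.Coprime b ∧ ℓ.Coprime k.natAbs) with h𝓛def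
  obtain ⟨h𝓛, hcard𝓛⟩ := kfp_primes_mem (L := L) b k
  set P : ℝ := (L : ℝ) / (4 * Real.log L) with hP
  set γ : ℕ → ℂ := fun n' => if (Squarefree n' ∧ n'.Coprime b) then β (b * n') else 0 with hγ
  set N' : ℝ := N / b with hN'
  set M₁ : ℕ := ⌊M⌋₊ with hM₁
  set M₂ : ℕ := ⌊2 * M⌋₊ with hM₂
  -- basic real facts
  have hb0 : (0 : ℝ) < b := by exact_mod_cast hb
  have hb1 : (1 : ℝ) ≤ b := by exact_mod_cast hb
  have hN0 : 0 < N := by linarith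
  have hM0 : 0 < M := by linarith
  have hLR : (2 : ℝ) ≤ L := by exact_mod_cast hL2
  have hL0 : (0 : ℝ) < L := by linarith
  have hlogL : 0 < Real.log L := Real.log_pos (by linarith)
  have hlogL2 : Real.log 2 ≤ Real.log L := Real.log_le_log (by norm_num) hLR
  have hlog2 : 0 < Real.log 2 := Real.log_pos (by norm_num)
  have hbleN : (b : ℝ) ≤ N := by nlinarith
  have hN'1 : 1 ≤ N' := by rw [hN', le_div_iff₀ hb0]; linarith
  have hN'0 : 0 < N' := by linarith
  have hN'N : N' ≤ N := by rw [hN']; exact div_le_self hN0.le hb1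
  have hN'half : 1 / 2 ≤ N' := by linarith
  have hbN' : (b : ℝ) * N' = N := by rw [hN']; field_simp
  have hM₂R : (M₂ : ℝ) ≤ 2 * M := Nat.floor_le (by linarith)
  have hM₁R : M ≤ (M₁ : ℝ) + 1 := (Nat.lt_floor_add_one M).le
  have hM₁R' : (M₁ : ℝ) + 1 ≤ 2 * M := by
    have : (M₁ : ℝ) ≤ M := Nat.floor_le hM0.le
    linarith
  have hM₁₂ : M₁ ≤ M₂ := Nat.floor_le_floor (by linarith)
  have hdiff : (M₂ : ℝ) - M₁ ≤ 2 * M := by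
    have : (0 : ℝ) ≤ M₁ := Nat.cast_nonneg _
    linarith
  have hcardR : (𝓛.card : ℝ) ≤ L := by exact_mod_cast hcard𝓛
  have hP0 : 0 < P := by rw [hP]; positivity
  -- `P ≤ #{ℓ ∈ 𝓛 : (ℓ, m) = 1}`
  have hP𝓛 : ∀ m ∈ (Ioc M₁ M₂).filter (fun m => m.Coprime b),
      P ≤ ((𝓛.filter (fun ℓ => ℓ.Coprime m)).card : ℝ) := by
    intro m hm
    have hm' := Finset.mem_Ioc.mp (Finset.mem_filter.mp hm).1
    have hm0 : 0 < m := by omega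
    have h1 := kfp_primes_coprime_card hL₀ hL hL2 hb hk hm0
    refine le_trans ?_ h1
    have hlogm : Real.log m ≤ Real.log M₂ :=
      Real.log_le_log (by exact_mod_cast hm0) (by exact_mod_cast hm'.2)
    have h2 : (Real.log b + Real.log k.natAbs + Real.log m) / Real.log L ≤ (L : ℝ) / (4 * Real.log L) := by
      rw [div_le_div_iff₀ hlogL (by positivity)]
      have : Real.log b + Real.log k.natAbs + Real.log m ≤ (L : ℝ) / 4 := by linarith
      calc (Real.log b + Real.log k.natAbs + Real.log m) * (4 * Real.log L)
          = 4 * (Real.log b + Real.log k.natAbs + Real.log m) * Real.log L := by ring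
        _ ≤ (L : ℝ) * Real.log L := mul_le_mul_of_nonneg_right (by linarith) hlogL.le
    have h3 : (L : ℝ) / (2 * Real.log L) - (L : ℝ) / (4 * Real.log L) = P := by
      rw [hP]; field_simp; ring
    linarith
  -- hypotheses on `γ`
  have hγsupp : ∀ n', γ n' ≠ 0 → (Squarefree n' ∧ n'.Coprime b) ∧ β (b * n') ≠ 0 := by
    intro n' h
    simp only [hγ] at h
    by_cases hc : Squarefree n' ∧ n'.Coprime b
    · rw [if_pos hc] at h; exact ⟨hc, h⟩
    · rw [if_neg hc] at h; exact absurd rfl h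
  have hγhyp : ∀ n', γ n' ≠ 0 → N' < n' ∧ n'.Coprime b ∧ Int.gcd k n' = 1 ∧ Squarefree n' := by
    intro n' h
    obtain ⟨⟨hsq, hcop⟩, hβ0⟩ := hγsupp n' h
    obtain ⟨h1, _, h3⟩ := hβ (b * n') hβ0
    refine ⟨?_, hcop, ?_, hsq⟩
    · rw [hN', div_lt_iff₀ hb0]
      push_cast at h1
      linarith [mul_comm (b : ℝ) n']
    · rw [Int.gcd_eq_natAbs, Int.natAbs_natCast]
      exact (Nat.Coprime.coprime_mul_left h3).symm
  have hX2N : 2 * N ≤ 16 * (L : ℝ) ^ 2 *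
      (N / b + (⌈4 * (L : ℝ) * (N / b) / ((⌊M⌋₊ : ℝ) + 1)⌉₊ : ℝ)) + 2 * b * (N / b) := by
    have h1 : 2 * (b : ℝ) * (N / b) = 2 * N := by field_simp
    have h2 : (0 : ℝ) ≤ 16 * (L : ℝ) ^ 2 *
        (N / b + (⌈4 * (L : ℝ) * (N / b) / ((⌊M⌋₊ : ℝ) + 1)⌉₊ : ℝ)) := by positivity
    linarith
  have hγτ : ∀ n', γ n' ≠ 0 → (((b * n').divisors.card : ℕ) : ℝ) ≤ T' := by
    intro n' h
    obtain ⟨_, hβ0⟩ := hγsupp n' h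
    obtain ⟨h1, h2, _⟩ := hβ (b * n') hβ0
    have hpos : 0 < b * n' := by
      have : (0 : ℝ) < ((b * n' : ℕ) : ℝ) := by linarith
      exact_mod_cast this
    exact hT' (b * n') hpos (h2.trans hX2N)
  have hT'1 : 1 ≤ T' := by
    have h := hT' 1 le_rfl (by push_cast; linarith)
    simpa using h
  have hT'0 : 0 ≤ T' := by linarith
  -- the dispersion bound
  have hCb := kfCb_le k hb hkb γ hN'half hγhyp hL2 𝓛 h𝓛 hM₁₂ hP0 hP𝓛 hγτ hT'
  -- simplification of the pieces
  set R : ℝ := Real.log (2 * N) / Real.log L with hRdef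
  set R₁ : ℝ := Real.log (2 * N') / Real.log L with hR₁def
  have hR₁0 : 0 ≤ R₁ := by
    rw [hR₁def]; exact div_nonneg (Real.log_nonneg (by linarith)) hlogL.le
  have hR₁R : R₁ ≤ R := by
    rw [hR₁def, hRdef]
    exact div_le_div_of_nonneg_right (Real.log_le_log (by linarith) (by linarith)) hlogL.le
  have hR0 : 0 ≤ R := hR₁0.trans hR₁R
  have hLN : (b : ℝ) * L * N' = L * N := by rw [hN']; field_simp
  have hlog4 : 0 ≤ Real.log (4 * ((L : ℝ) * N)) := Real.log_nonneg (by nlinarith)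
  set F₀ : ℝ := 1 + 64 * Real.pi * |(k : ℝ)| / (M * N) with hF₀
  set Q : ℝ := T' * L * Real.sqrt (8 * (N / b)) * (1 + Real.log (8 * (L : ℝ) ^ 2 * N)) with hQ
  have hlog8 : 0 ≤ Real.log (8 * (L : ℝ) ^ 2 * N') := Real.log_nonneg (by nlinarith)
  have hQ0 : 0 ≤ Q := by
    rw [hQ]
    have : 0 ≤ Real.log (8 * (L : ℝ) ^ 2 * N) := Real.log_nonneg (by nlinarith)
    positivity
  -- DIAG
  have hDIAG : 𝓛.card * ((M₂ : ℝ) - M₁) + Real.log (2 * N') / Real.log L *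
      (4 * T' * ((M₂ : ℝ) - M₁) / (b * N') +
        16 * T' ^ 2 * L * Real.sqrt (b * L * N') * (1 + Real.log (4 * (b * L * N')))) ≤
      2 * L * M + R * (8 * T' * M / N +
        16 * T' ^ 2 * L * Real.sqrt (L * N) * (1 + Real.log (4 * (L * N)))) := by
    have hd0 : (0 : ℝ) ≤ (M₂ : ℝ) - M₁ := by
      have : (M₁ : ℝ) ≤ M₂ := by exact_mod_cast hM₁₂
      linarith
    have t1 : (𝓛.card : ℝ) * ((M₂ : ℝ) - M₁) ≤ 2 * L * M := by
      calc (𝓛.card : ℝ) * ((M₂ : ℝ) - M₁) ≤ L * (2 * M) := mul_le_mul hcardR hdiff hd0 hL0.le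
        _ = 2 * L * M := by ring
    have e1 : (b : ℝ) * L * N' = L * N := hLN
    have e2 : 4 * T' * ((M₂ : ℝ) - M₁) / (b * N') = 4 * T' * ((M₂ : ℝ) - M₁) / N := by rw [hbN']
    have t2 : 4 * T' * ((M₂ : ℝ) - M₁) / (b * N') +
        16 * T' ^ 2 * L * Real.sqrt (b * L * N') * (1 + Real.log (4 * (b * L * N'))) ≤
        8 * T' * M / N + 16 * T' ^ 2 * L * Real.sqrt (L * N) * (1 + Real.log (4 * (L * N))) := by
      rw [e2, e1]
      have : 4 * T' * ((M₂ : ℝ) - M₁) / N ≤ 8 * T' * M / N := by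
        refine div_le_div_of_nonneg_right ?_ hN0.le
        nlinarith
      linarith
    have t2' : 0 ≤ 8 * T' * M / N + 16 * T' ^ 2 * L * Real.sqrt (L * N) *
        (1 + Real.log (4 * (L * N))) := by positivity
    show (𝓛.card : ℝ) * ((M₂ : ℝ) - M₁) + R₁ * _ ≤ 2 * L * M + R * _
    have := mul_le_mul hR₁R t2 (by rw [e2, e1]; positivity) hR0
    linarith
  -- OFF
  have hOFF : (𝓛.card : ℝ) * (2 * N') * (1 + 4 * (Real.log (2 * N') / Real.log L)) +
      (T' * L * ((M₁ : ℝ) + 1) / 2 + Real.sqrt (L * b * (L *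
        (32 * (L : ℝ) ^ 2 * N' ^ 2 * (((M₂ : ℝ) - M₁) / L + 1) / ((M₁ : ℝ) + 1) +
          6144 * T' ^ 2 * (L : ℝ) ^ 4 * N' ^ 3 *
            (1 + 64 * Real.pi * |(k : ℝ)| / ((b : ℝ) * ((M₁ : ℝ) + 1) * N')) *
            (9 + T' * L * Real.sqrt (8 * N') * (1 + Real.log (8 * (L : ℝ) ^ 2 * N'))) /
            ((M₁ : ℝ) + 1) ^ 2)))) ≤
      2 * L * N * (1 + 4 * R) / b + T' * L * M + 8 * L * Real.sqrt L * N / Real.sqrt b +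
        Real.sqrt 32 * (L : ℝ) ^ 2 * N / (Real.sqrt b * Real.sqrt M) +
        79 * T' * (L : ℝ) ^ 3 * N * Real.sqrt N * Real.sqrt F₀ * (3 + Real.sqrt Q) / (b * M) := by
    have t1 : (𝓛.card : ℝ) * (2 * N') * (1 + 4 * R₁) ≤ 2 * L * N * (1 + 4 * R) / b := by
      calc (𝓛.card : ℝ) * (2 * N') * (1 + 4 * R₁) ≤ L * (2 * N') * (1 + 4 * R) :=
            mul_le_mul (mul_le_mul_of_nonneg_right hcardR (by positivity)) (by linarith)
              (by positivity) (by positivity)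
        _ = 2 * L * N * (1 + 4 * R) / b := by rw [hN']; field_simp
    have t2 : T' * L * ((M₁ : ℝ) + 1) / 2 ≤ T' * L * M := by
      have : T' * L * ((M₁ : ℝ) + 1) ≤ T' * L * (2 * M) :=
        mul_le_mul_of_nonneg_left hM₁R' (by positivity)
      linarith
    have hMN : M * N ≤ (b : ℝ) * ((M₁ : ℝ) + 1) * N' := by
      rw [show (b : ℝ) * ((M₁ : ℝ) + 1) * N' = ((M₁ : ℝ) + 1) * (b * N') by ring, hbN']
      exact mul_le_mul_of_nonneg_right hM₁R hN0.le
    have hF : 1 + 64 * Real.pi * |(k : ℝ)| / ((b : ℝ) * ((M₁ : ℝ) + 1) * N') ≤ F₀ := by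
      rw [hF₀]
      have := div_le_div_of_nonneg_left (by positivity : 0 ≤ 64 * Real.pi * |(k : ℝ)|)
        (by positivity) hMN
      linarith
    have hC : 9 + T' * L * Real.sqrt (8 * N') * (1 + Real.log (8 * (L : ℝ) ^ 2 * N')) ≤ 9 + Q := by
      rw [hQ]
      have h1 : Real.log (8 * (L : ℝ) ^ 2 * N') ≤ Real.log (8 * (L : ℝ) ^ 2 * N) :=
        Real.log_le_log (by positivity) (by nlinarith)
      have h2 : T' * L * Real.sqrt (8 * N') * (1 + Real.log (8 * (L : ℝ) ^ 2 * N')) ≤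
          T' * L * Real.sqrt (8 * (N / b)) * (1 + Real.log (8 * (L : ℝ) ^ 2 * N)) :=
        mul_le_mul_of_nonneg_left (by linarith) (by positivity)
      linarith
    have t3 := kfm_sqrt_theta_le (L := (L : ℝ)) (b := (b : ℝ)) (N := N) (M := M) (T' := T')
      (F := 1 + 64 * Real.pi * |(k : ℝ)| / ((b : ℝ) * ((M₁ : ℝ) + 1) * N'))
      (C := 9 + T' * L * Real.sqrt (8 * N') * (1 + Real.log (8 * (L : ℝ) ^ 2 * N')))
      (F₀ := F₀) (Q := Q) (Dg := ((M₂ : ℝ) - M₁) / L + 1) (Mp := (M₁ : ℝ) + 1)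
      hL0 hb0 hN0 hM0 hT'0 (by positivity) (by positivity) hQ0 (by
        have := div_le_div_of_nonneg_right hdiff hL0.le
        linarith) hM₁R hF hC
    rw [← hR₁def]
    have e : N' = N / b := hN'
    linarith [t1, t2, t3]
  -- the prefactor
  have hpre : (M₂ : ℝ) / P ^ 2 ≤ 32 * M * Real.log L ^ 2 / (L : ℝ) ^ 2 := by
    have e : (M₂ : ℝ) / P ^ 2 = 16 * M₂ * Real.log L ^ 2 / (L : ℝ) ^ 2 := by
      rw [hP]; field_simp; ring
    rw [e]
    refine div_le_div_of_nonneg_right ?_ (by positivity)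
    nlinarith [sq_nonneg (Real.log L)]
  -- nonnegativity of the pieces
  have hG0 : 0 ≤ ∑ n ∈ Icc 1 ⌊2 * N'⌋₊, ‖γ n‖ ^ 2 := Finset.sum_nonneg fun n _ => by positivity
  have hd0 : (0 : ℝ) ≤ (M₂ : ℝ) - M₁ := by
    have : (M₁ : ℝ) ≤ M₂ := by exact_mod_cast hM₁₂
    linarith
  have hlog4' : 0 ≤ Real.log (4 * ((b : ℝ) * L * N')) := by rw [hLN]; exact hlog4
  have hDIAG0 : 0 ≤ 𝓛.card * ((M₂ : ℝ) - M₁) + Real.log (2 * N') / Real.log L *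
      (4 * T' * ((M₂ : ℝ) - M₁) / (b * N') +
        16 * T' ^ 2 * L * Real.sqrt (b * L * N') * (1 + Real.log (4 * (b * L * N')))) := by
    positivity
  have hOFF0 : 0 ≤ (𝓛.card : ℝ) * (2 * N') * (1 + 4 * (Real.log (2 * N') / Real.log L)) +
      (T' * L * ((M₁ : ℝ) + 1) / 2 + Real.sqrt (L * b * (L *
        (32 * (L : ℝ) ^ 2 * N' ^ 2 * (((M₂ : ℝ) - M₁) / L + 1) / ((M₁ : ℝ) + 1) +
          6144 * T' ^ 2 * (L : ℝ) ^ 4 * N' ^ 3 *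
            (1 + 64 * Real.pi * |(k : ℝ)| / ((b : ℝ) * ((M₁ : ℝ) + 1) * N')) *
            (9 + T' * L * Real.sqrt (8 * N') * (1 + Real.log (8 * (L : ℝ) ^ 2 * N'))) /
            ((M₁ : ℝ) + 1) ^ 2)))) := by
    have : 0 ≤ Real.log (2 * N') / Real.log L := hR₁0
    positivity
  -- combine
  refine hCb.trans ?_
  have hmid := add_le_add hDIAG (mul_le_mul_of_nonneg_left hOFF hT'0)
  calc (M₂ : ℝ) / P ^ 2 * (∑ n ∈ Icc 1 ⌊2 * N'⌋₊, ‖γ n‖ ^ 2) * _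
      ≤ (32 * M * Real.log L ^ 2 / (L : ℝ) ^ 2) * (∑ n ∈ Icc 1 ⌊2 * N'⌋₊, ‖γ n‖ ^ 2) * _ :=
        mul_le_mul (mul_le_mul_of_nonneg_right hpre hG0) hmid (by positivity) (by positivity)
    _ = _ := by ring

/-! ### Simplifying the slowly varying factors -/

set_option maxHeartbeats 4000000 in
/-- **Slowly varying factors**: if `S ≥ 1` bounds `T'`, `log L`, `log 2N/log L`, `1 + log 4LN`
and `1 + log 8L²N`, then `b^{1/2} · BOUND` is at most `S⁶ F₀^{1/2}` times eight explicit
monomials (`F₀ ≥ 1`). [folklore] -/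
theorem kfm_bound_le_terms {M N b L T' S F₀ : ℝ} (hM : 1 ≤ M) (hN : 1 ≤ N) (hb : 1 ≤ b)
    (hL : 2 ≤ L) (hS : 1 ≤ S) (hT'0 : 0 ≤ T') (hT'S : T' ≤ S)
    (hlogL : Real.log L ≤ S) (hR : Real.log (2 * N) / Real.log L ≤ S)
    (hl4 : 1 + Real.log (4 * (L * N)) ≤ S) (hl8 : 1 + Real.log (8 * L ^ 2 * N) ≤ S)
    (hF₀ : 1 ≤ F₀) :
    Real.sqrt b * (32 * M * Real.log L ^ 2 / L ^ 2 *
        (2 * L * M + Real.log (2 * N) / Real.log L *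
          (8 * T' * M / N + 16 * T' ^ 2 * L * Real.sqrt (L * N) * (1 + Real.log (4 * (L * N)))) +
        T' * (2 * L * N * (1 + 4 * (Real.log (2 * N) / Real.log L)) / b + T' * L * M +
          8 * L * Real.sqrt L * N / Real.sqrt b +
          Real.sqrt 32 * L ^ 2 * N / (Real.sqrt b * Real.sqrt M) +
          79 * T' * L ^ 3 * N * Real.sqrt N * Real.sqrt F₀ *
            (3 + Real.sqrt (T' * L * Real.sqrt (8 * (N / b)) *
              (1 + Real.log (8 * L ^ 2 * N)))) / (b * M)))) ≤
      S ^ 6 * Real.sqrt F₀ * (96 * (M ^ 2 * Real.sqrt b / L) +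
        256 * (M ^ 2 * Real.sqrt b / (N * L ^ 2)) +
        512 * (M * Real.sqrt b * Real.sqrt (L * N) / L) + 320 * (M * N * Real.sqrt b / (L * b)) +
        256 * (M * N * Real.sqrt L / L) + 192 * (M * N / Real.sqrt M) +
        7584 * (L * N * Real.sqrt N * Real.sqrt b / b) +
        2528 * (L * Real.sqrt L * N * Real.sqrt N * Real.sqrt (Real.sqrt (8 * (N / b))) *
          Real.sqrt b / b)) := by
  -- positivity facts
  have hM0 : 0 < M := by linarith
  have hN0 : 0 < N := by linarith
  have hb0 : 0 < b := by linarith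
  have hL0 : 0 < L := by linarith
  have hS0 : 0 < S := by linarith
  have hlogL0 : 0 < Real.log L := Real.log_pos (by linarith)
  set R : ℝ := Real.log (2 * N) / Real.log L with hRdef
  have hR0 : 0 ≤ R := div_nonneg (Real.log_nonneg (by linarith)) hlogL0.le
  have hsb : 0 < Real.sqrt b := Real.sqrt_pos.mpr hb0
  have hsL : 0 < Real.sqrt L := Real.sqrt_pos.mpr hL0
  have hsN : 0 < Real.sqrt N := Real.sqrt_pos.mpr hN0
  have hsM : 0 < Real.sqrt M := Real.sqrt_pos.mpr hM0
  have hsF : 1 ≤ Real.sqrt F₀ := by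
    have := Real.sqrt_le_sqrt hF₀
    rwa [Real.sqrt_one] at this
  have hl4' : 0 ≤ Real.log (4 * (L * N)) := Real.log_nonneg (by nlinarith)
  have hl8' : 0 ≤ Real.log (8 * L ^ 2 * N) := Real.log_nonneg (by nlinarith)
  have hS2 : Real.log L ^ 2 ≤ S ^ 2 := pow_le_pow_left₀ hlogL0.le hlogL 2
  have h32 : Real.sqrt 32 ≤ 6 := by
    rw [Real.sqrt_le_left (by norm_num)]; norm_num
  -- the monomials
  set m1 : ℝ := M ^ 2 * Real.sqrt b / L with hm1
  set m2 : ℝ := M ^ 2 * Real.sqrt b / (N * L ^ 2) with hm2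
  set m3 : ℝ := M * Real.sqrt b * Real.sqrt (L * N) / L with hm3
  set m4 : ℝ := M * N * Real.sqrt b / (L * b) with hm4
  set m6 : ℝ := M * N * Real.sqrt L / L with hm6
  set m7 : ℝ := M * N / Real.sqrt M with hm7
  set m8 : ℝ := L * N * Real.sqrt N * Real.sqrt b / b with hm8
  set m9 : ℝ := L * Real.sqrt L * N * Real.sqrt N * Real.sqrt (Real.sqrt (8 * (N / b))) *
    Real.sqrt b / b with hm9
  -- `D ≤ D'`
  set D : ℝ := 2 * L * M + R * (8 * T' * M / N + 16 * T' ^ 2 * L * Real.sqrt (L * N) *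
    (1 + Real.log (4 * (L * N)))) with hD
  set D' : ℝ := 2 * L * M + (8 * S ^ 2 * M / N + 16 * S ^ 4 * L * Real.sqrt (L * N)) with hD'
  have hDD : D ≤ D' := by
    rw [hD, hD']
    have h1 : 8 * T' * M / N ≤ 8 * S * M / N :=
      div_le_div_of_nonneg_right (by nlinarith) hN0.le
    have h2 : 16 * T' ^ 2 * L * Real.sqrt (L * N) * (1 + Real.log (4 * (L * N))) ≤
        16 * S ^ 2 * L * Real.sqrt (L * N) * S := by
      have hT2 : T' ^ 2 ≤ S ^ 2 := pow_le_pow_left₀ hT'0 hT'S 2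
      exact mul_le_mul (mul_le_mul_of_nonneg_right (mul_le_mul_of_nonneg_right
        (mul_le_mul_of_nonneg_left hT2 (by norm_num)) hL0.le) (Real.sqrt_nonneg _)) hl4
        (by positivity) (by positivity)
    have h3 : R * (8 * T' * M / N + 16 * T' ^ 2 * L * Real.sqrt (L * N) *
        (1 + Real.log (4 * (L * N)))) ≤ S * (8 * S * M / N + 16 * S ^ 2 * L * Real.sqrt (L * N) * S) :=
      mul_le_mul hR (add_le_add h1 h2) (by positivity) hS0.le
    have h4 : S * (8 * S * M / N + 16 * S ^ 2 * L * Real.sqrt (L * N) * S) =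
        8 * S ^ 2 * M / N + 16 * S ^ 4 * L * Real.sqrt (L * N) := by ring
    linarith
  -- `O ≤ O'`
  set Q : ℝ := T' * L * Real.sqrt (8 * (N / b)) * (1 + Real.log (8 * L ^ 2 * N)) with hQ
  set O : ℝ := 2 * L * N * (1 + 4 * R) / b + T' * L * M + 8 * L * Real.sqrt L * N / Real.sqrt b +
    Real.sqrt 32 * L ^ 2 * N / (Real.sqrt b * Real.sqrt M) +
    79 * T' * L ^ 3 * N * Real.sqrt N * Real.sqrt F₀ * (3 + Real.sqrt Q) / (b * M) with hO
  set O' : ℝ := 10 * S * L * N / b + S * L * M + 8 * L * Real.sqrt L * N / Real.sqrt b +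
    6 * L ^ 2 * N / (Real.sqrt b * Real.sqrt M) +
    79 * S * L ^ 3 * N * Real.sqrt N * Real.sqrt F₀ *
      (3 + S * Real.sqrt L * Real.sqrt (Real.sqrt (8 * (N / b)))) / (b * M) with hO'
  have hQ0 : 0 ≤ Q := by rw [hQ]; positivity
  have hsqrtQ : Real.sqrt Q ≤ S * Real.sqrt L * Real.sqrt (Real.sqrt (8 * (N / b))) := by
    have h1 : Q ≤ S ^ 2 * (L * Real.sqrt (8 * (N / b))) := by
      rw [hQ]
      calc T' * L * Real.sqrt (8 * (N / b)) * (1 + Real.log (8 * L ^ 2 * N))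
          ≤ S * L * Real.sqrt (8 * (N / b)) * S :=
            mul_le_mul (mul_le_mul_of_nonneg_right (mul_le_mul_of_nonneg_right hT'S hL0.le)
              (Real.sqrt_nonneg _)) hl8 (by positivity) (by positivity)
        _ = S ^ 2 * (L * Real.sqrt (8 * (N / b))) := by ring
    calc Real.sqrt Q ≤ Real.sqrt (S ^ 2 * (L * Real.sqrt (8 * (N / b)))) := Real.sqrt_le_sqrt h1
      _ = S * Real.sqrt L * Real.sqrt (Real.sqrt (8 * (N / b))) := by
          rw [Real.sqrt_mul (by positivity), Real.sqrt_sq hS0.le, Real.sqrt_mul hL0.le]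
          ring
  have hOO : O ≤ O' := by
    rw [hO, hO']
    have h1 : 2 * L * N * (1 + 4 * R) / b ≤ 10 * S * L * N / b := by
      refine div_le_div_of_nonneg_right ?_ hb0.le
      have : 1 + 4 * R ≤ 5 * S := by linarith
      calc 2 * L * N * (1 + 4 * R) ≤ 2 * L * N * (5 * S) :=
            mul_le_mul_of_nonneg_left this (by positivity)
        _ = 10 * S * L * N := by ring
    have h2 : T' * L * M ≤ S * L * M :=
      mul_le_mul_of_nonneg_right (mul_le_mul_of_nonneg_right hT'S hL0.le) hM0.le
    have h3 : Real.sqrt 32 * L ^ 2 * N / (Real.sqrt b * Real.sqrt M) ≤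
        6 * L ^ 2 * N / (Real.sqrt b * Real.sqrt M) :=
      div_le_div_of_nonneg_right (mul_le_mul_of_nonneg_right
        (mul_le_mul_of_nonneg_right h32 (by positivity)) hN0.le) (by positivity)
    have h4 : 79 * T' * L ^ 3 * N * Real.sqrt N * Real.sqrt F₀ * (3 + Real.sqrt Q) / (b * M) ≤
        79 * S * L ^ 3 * N * Real.sqrt N * Real.sqrt F₀ *
          (3 + S * Real.sqrt L * Real.sqrt (Real.sqrt (8 * (N / b)))) / (b * M) := by
      refine div_le_div_of_nonneg_right ?_ (by positivity)
      refine mul_le_mul ?_ (by linarith) (by positivity) (by positivity)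
      exact mul_le_mul_of_nonneg_right (mul_le_mul_of_nonneg_right (mul_le_mul_of_nonneg_right
        (mul_le_mul_of_nonneg_right (mul_le_mul_of_nonneg_left hT'S (by norm_num)) (by positivity))
        hN0.le) (Real.sqrt_nonneg _)) (Real.sqrt_nonneg _)
    linarith
  have hO0 : 0 ≤ O := by rw [hO]; positivity
  -- the prefactor
  set P : ℝ := 32 * M * Real.sqrt b / L ^ 2 with hP
  have hpre : Real.sqrt b * (32 * M * Real.log L ^ 2 / L ^ 2) ≤ S ^ 2 * P := by
    rw [hP]
    have e : Real.sqrt b * (32 * M * Real.log L ^ 2 / L ^ 2) =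
        Real.log L ^ 2 * (32 * M * Real.sqrt b / L ^ 2) := by ring
    rw [e]
    exact mul_le_mul_of_nonneg_right hS2 (by positivity)
  -- main estimate
  have hmain : Real.sqrt b * (32 * M * Real.log L ^ 2 / L ^ 2 * (D + T' * O)) ≤
      S ^ 2 * P * (D' + S * O') := by
    have e : Real.sqrt b * (32 * M * Real.log L ^ 2 / L ^ 2 * (D + T' * O)) =
        (Real.sqrt b * (32 * M * Real.log L ^ 2 / L ^ 2)) * (D + T' * O) := by ring
    rw [e]
    have hD0 : 0 ≤ D := by rw [hD]; positivity
    exact mul_le_mul hpre (add_le_add hDD (mul_le_mul hT'S hOO hO0 hS0.le))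
      (by positivity) (by positivity)
  -- expand `S² P (D' + S O')` into the monomials
  have hexp : S ^ 2 * P * (D' + S * O') =
      64 * S ^ 2 * m1 + 256 * S ^ 4 * m2 + 512 * S ^ 6 * m3 +
      (320 * S ^ 4 * m4 + 32 * S ^ 4 * m1 + 256 * S ^ 3 * m6 + 192 * S ^ 3 * m7 +
        7584 * S ^ 4 * Real.sqrt F₀ * m8 + 2528 * S ^ 5 * Real.sqrt F₀ * m9) := by
    rw [hP, hD', hO', hm1, hm2, hm3, hm4, hm6, hm7, hm8, hm9]
    field_simp
    ring
  -- bound the powers of `S` by `S⁶` and insert `√F₀ ≥ 1`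
  have hS3 : S ^ 3 ≤ S ^ 6 := pow_le_pow_right₀ hS (by norm_num)
  have hS4 : S ^ 4 ≤ S ^ 6 := pow_le_pow_right₀ hS (by norm_num)
  have hS5 : S ^ 5 ≤ S ^ 6 := pow_le_pow_right₀ hS (by norm_num)
  have hS2' : S ^ 2 ≤ S ^ 6 := pow_le_pow_right₀ hS (by norm_num)
  have hS60 : 0 ≤ S ^ 6 := by positivity
  have hm1p : 0 ≤ m1 := by positivity
  have hm2p : 0 ≤ m2 := by positivity
  have hm3p : 0 ≤ m3 := by positivity
  have hm4p : 0 ≤ m4 := by positivity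
  have hm6p : 0 ≤ m6 := by positivity
  have hm7p : 0 ≤ m7 := by positivity
  have hm8p : 0 ≤ m8 := by positivity
  have hm9p : 0 ≤ m9 := by positivity
  have key : 64 * S ^ 2 * m1 + 256 * S ^ 4 * m2 + 512 * S ^ 6 * m3 +
      (320 * S ^ 4 * m4 + 32 * S ^ 4 * m1 + 256 * S ^ 3 * m6 + 192 * S ^ 3 * m7 +
        7584 * S ^ 4 * Real.sqrt F₀ * m8 + 2528 * S ^ 5 * Real.sqrt F₀ * m9) ≤
      S ^ 6 * Real.sqrt F₀ * (96 * m1 + 256 * m2 + 512 * m3 + 320 * m4 + 256 * m6 + 192 * m7 +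
        7584 * m8 + 2528 * m9) := by
    have hSF : S ^ 6 ≤ S ^ 6 * Real.sqrt F₀ := le_mul_of_one_le_right hS60 hsF
    have hsF0 : 0 ≤ Real.sqrt F₀ := Real.sqrt_nonneg _
    have g2 : S ^ 2 ≤ S ^ 6 * Real.sqrt F₀ := hS2'.trans hSF
    have g3 : S ^ 3 ≤ S ^ 6 * Real.sqrt F₀ := hS3.trans hSF
    have g4 : S ^ 4 ≤ S ^ 6 * Real.sqrt F₀ := hS4.trans hSF
    have g6 : S ^ 6 ≤ S ^ 6 * Real.sqrt F₀ := hSF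
    have e1a := mul_le_mul_of_nonneg_right g2 (by positivity : 0 ≤ 64 * m1)
    have e1b := mul_le_mul_of_nonneg_right g4 (by positivity : 0 ≤ 32 * m1)
    have e2 := mul_le_mul_of_nonneg_right g4 (by positivity : 0 ≤ 256 * m2)
    have e3 := mul_le_mul_of_nonneg_right g6 (by positivity : 0 ≤ 512 * m3)
    have e4 := mul_le_mul_of_nonneg_right g4 (by positivity : 0 ≤ 320 * m4)
    have e6 := mul_le_mul_of_nonneg_right g3 (by positivity : 0 ≤ 256 * m6)
    have e7 := mul_le_mul_of_nonneg_right g3 (by positivity : 0 ≤ 192 * m7)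
    have e8 := mul_le_mul_of_nonneg_right hS4 (by positivity : 0 ≤ 7584 * Real.sqrt F₀ * m8)
    have e9 := mul_le_mul_of_nonneg_right hS5 (by positivity : 0 ≤ 2528 * Real.sqrt F₀ * m9)
    have eL : 64 * S ^ 2 * m1 + 256 * S ^ 4 * m2 + 512 * S ^ 6 * m3 +
        (320 * S ^ 4 * m4 + 32 * S ^ 4 * m1 + 256 * S ^ 3 * m6 + 192 * S ^ 3 * m7 +
          7584 * S ^ 4 * Real.sqrt F₀ * m8 + 2528 * S ^ 5 * Real.sqrt F₀ * m9) =
        S ^ 2 * (64 * m1) + S ^ 4 * (256 * m2) + S ^ 6 * (512 * m3) +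
        (S ^ 4 * (320 * m4) + S ^ 4 * (32 * m1) + S ^ 3 * (256 * m6) + S ^ 3 * (192 * m7) +
          S ^ 4 * (7584 * Real.sqrt F₀ * m8) + S ^ 5 * (2528 * Real.sqrt F₀ * m9)) := by ring
    have eR : S ^ 6 * Real.sqrt F₀ * (96 * m1 + 256 * m2 + 512 * m3 + 320 * m4 + 256 * m6 +
        192 * m7 + 7584 * m8 + 2528 * m9) =
        S ^ 6 * Real.sqrt F₀ * (64 * m1) + S ^ 6 * Real.sqrt F₀ * (256 * m2) +
        S ^ 6 * Real.sqrt F₀ * (512 * m3) +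
        (S ^ 6 * Real.sqrt F₀ * (320 * m4) + S ^ 6 * Real.sqrt F₀ * (32 * m1) +
          S ^ 6 * Real.sqrt F₀ * (256 * m6) + S ^ 6 * Real.sqrt F₀ * (192 * m7) +
          S ^ 6 * (7584 * Real.sqrt F₀ * m8) + S ^ 6 * (2528 * Real.sqrt F₀ * m9)) := by ring
    rw [eL, eR]
    linarith [e1a, e1b, e2, e3, e4, e6, e7, e8, e9]
  calc _ = Real.sqrt b * (32 * M * Real.log L ^ 2 / L ^ 2 * (D + T' * O)) := by rw [hD, hO, hQ]
    _ ≤ S ^ 2 * P * (D' + S * O') := hmain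
    _ = _ := hexp
    _ ≤ _ := key

/-! ### The monomials against the target `(MN)^{3/4}(M+N)^{11/24}` -/

set_option maxHeartbeats 2000000 in
/-- **The eight monomials are `≪ (MN)^{3/4}(M+N)^{11/24}`** on the window
`N^{5/6} ≤ M ≤ N^{6/5}`, `1 ≤ b ≤ N^{1/2}`, when `ℓ₁ = (b³M⁴/N³)^{1/8} ≤ L`,
`ℓ₂ = (b⁵M⁸/N⁷)^{1/10} ≤ L` and `L ≤ 8 max(ℓ₁, ℓ₂)` (the choice
`L = ⌈ℓ₁⌉ + ⌈ℓ₂⌉` of B–C §5 with `A = 1`; checked term by term by taking logarithms).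
[cite: BettinChandee2018, §5] -/
theorem kfm_terms_le_tgt {M N b L ℓ₁ ℓ₂ : ℝ} (hM : 1 ≤ M) (hN : 1 ≤ N) (hb : 1 ≤ b)
    (hbN : b ^ 2 ≤ N) (hw1 : N ^ 5 ≤ M ^ 6) (hw2 : M ^ 5 ≤ N ^ 6)
    (hℓ₁ : ℓ₁ = (b ^ 3 * M ^ 4 / N ^ 3) ^ (1 / 8 : ℝ))
    (hℓ₂ : ℓ₂ = (b ^ 5 * M ^ 8 / N ^ 7) ^ (1 / 10 : ℝ))
    (hL₁ : ℓ₁ ≤ L) (hL₂ : ℓ₂ ≤ L) (hLle : L ≤ 8 * max ℓ₁ ℓ₂) :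
    96 * (M ^ 2 * Real.sqrt b / L) + 256 * (M ^ 2 * Real.sqrt b / (N * L ^ 2)) +
        512 * (M * Real.sqrt b * Real.sqrt (L * N) / L) + 320 * (M * N * Real.sqrt b / (L * b)) +
        256 * (M * N * Real.sqrt L / L) + 192 * (M * N / Real.sqrt M) +
        7584 * (L * N * Real.sqrt N * Real.sqrt b / b) +
        2528 * (L * Real.sqrt L * N * Real.sqrt N * Real.sqrt (Real.sqrt (8 * (N / b))) *
          Real.sqrt b / b) ≤
      230000 * ((M * N) ^ (3 / 4 : ℝ) * (M + N) ^ (11 / 24 : ℝ)) := by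
  -- positivity
  have hM0 : 0 < M := by linarith
  have hN0 : 0 < N := by linarith
  have hb0 : 0 < b := by linarith
  have hℓ₁0 : 0 < ℓ₁ := by rw [hℓ₁]; positivity
  have hℓ₂0 : 0 < ℓ₂ := by rw [hℓ₂]; positivity
  have hL0 : 0 < L := hℓ₁0.trans_le hL₁
  -- logarithms
  set x := Real.log M with hx
  set y := Real.log N with hy
  set z := Real.log b with hz
  set t := Real.log (M + N) with ht
  set lL := Real.log L with hlL
  have hx0 : 0 ≤ x := Real.log_nonneg hM
  have hy0 : 0 ≤ y := Real.log_nonneg hN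
  have hz0 : 0 ≤ z := Real.log_nonneg hb
  have hzy : 2 * z ≤ y := by
    have := Real.log_le_log (by positivity) hbN
    rwa [Real.log_pow] at this
  have hw1' : 5 * y ≤ 6 * x := by
    have := Real.log_le_log (by positivity) hw1
    rw [Real.log_pow, Real.log_pow] at this
    exact_mod_cast this
  have hw2' : 5 * x ≤ 6 * y := by
    have := Real.log_le_log (by positivity) hw2
    rw [Real.log_pow, Real.log_pow] at this
    exact_mod_cast this
  have htx : x ≤ t := Real.log_le_log hM0 (by linarith)
  have hty : y ≤ t := Real.log_le_log hN0 (by linarith)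
  have hu₁ : Real.log ℓ₁ = (3 * z + 4 * x - 3 * y) / 8 := by
    rw [hℓ₁, Real.log_rpow (by positivity), Real.log_div (by positivity) (by positivity),
      Real.log_mul (by positivity) (by positivity), Real.log_pow, Real.log_pow, Real.log_pow]
    push_cast; ring
  have hu₂ : Real.log ℓ₂ = (5 * z + 8 * x - 7 * y) / 10 := by
    rw [hℓ₂, Real.log_rpow (by positivity), Real.log_div (by positivity) (by positivity),
      Real.log_mul (by positivity) (by positivity), Real.log_pow, Real.log_pow, Real.log_pow]
    push_cast; ring
  have hlL₁ : (3 * z + 4 * x - 3 * y) / 8 ≤ lL := hu₁ ▸ Real.log_le_log hℓ₁0 hL₁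
  have hlL₂ : (5 * z + 8 * x - 7 * y) / 10 ≤ lL := hu₂ ▸ Real.log_le_log hℓ₂0 hL₂
  have hlog8 : 0 ≤ Real.log 8 := Real.log_nonneg (by norm_num)
  have hcase : lL ≤ Real.log 8 + (3 * z + 4 * x - 3 * y) / 8 ∨
      lL ≤ Real.log 8 + (5 * z + 8 * x - 7 * y) / 10 := by
    rcases le_total ℓ₁ ℓ₂ with h | h
    · right
      have h1 : L ≤ 8 * ℓ₂ := by rwa [max_eq_right h] at hLle
      have := Real.log_le_log hL0 h1
      rw [Real.log_mul (by norm_num) hℓ₂0.ne', hu₂] at this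
      exact this
    · left
      have h1 : L ≤ 8 * ℓ₁ := by rwa [max_eq_left h] at hLle
      have := Real.log_le_log hL0 h1
      rw [Real.log_mul (by norm_num) hℓ₁0.ne', hu₁] at this
      exact this
  -- the target
  set TGT : ℝ := (M * N) ^ (3 / 4 : ℝ) * (M + N) ^ (11 / 24 : ℝ) with hTGT
  have hTGT0 : 0 < TGT := by rw [hTGT]; positivity
  have hlogT : Real.log TGT = 3 / 4 * (x + y) + 11 / 24 * t := by
    rw [hTGT, Real.log_mul (by positivity) (by positivity), Real.log_rpow (by positivity),
      Real.log_rpow (by positivity), Real.log_mul hM0.ne' hN0.ne']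
  have hsb0 : Real.sqrt b ≠ 0 := (Real.sqrt_pos.mpr hb0).ne'
  have hsL0 : Real.sqrt L ≠ 0 := (Real.sqrt_pos.mpr hL0).ne'
  have hsM0 : Real.sqrt M ≠ 0 := (Real.sqrt_pos.mpr hM0).ne'
  have hsN0 : Real.sqrt N ≠ 0 := (Real.sqrt_pos.mpr hN0).ne'
  -- a generic step: `m ≤ C · TGT` from `log m ≤ log C + log TGT`
  have step : ∀ {m C : ℝ}, 0 < m → 0 < C → Real.log m ≤ Real.log C + Real.log TGT → m ≤ C * TGT := by
    intro m C hm hC h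
    rw [← Real.log_le_log_iff hm (by positivity), Real.log_mul hC.ne' hTGT0.ne']
    exact h
  have hlog1 : Real.log (1 : ℝ) = 0 := Real.log_one
  -- m1
  have f1 : M ^ 2 * Real.sqrt b / L ≤ 1 * TGT := by
    refine step (by positivity) one_pos ?_
    rw [Real.log_div (by positivity) hL0.ne', Real.log_mul (by positivity) hsb0, Real.log_pow,
      Real.log_sqrt hb0.le, hlog1, hlogT]
    push_cast
    linarith
  -- m2
  have f2 : M ^ 2 * Real.sqrt b / (N * L ^ 2) ≤ 1 * TGT := by
    refine step (by positivity) one_pos ?_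
    rw [Real.log_div (by positivity) (by positivity), Real.log_mul (by positivity) hsb0,
      Real.log_pow, Real.log_sqrt hb0.le, Real.log_mul hN0.ne' (by positivity), Real.log_pow,
      hlog1, hlogT]
    push_cast
    linarith
  -- m3
  have f3 : M * Real.sqrt b * Real.sqrt (L * N) / L ≤ 1 * TGT := by
    refine step (by positivity) one_pos ?_
    rw [Real.log_div (by positivity) hL0.ne', Real.log_mul (by positivity) (by positivity),
      Real.log_mul hM0.ne' hsb0, Real.log_sqrt hb0.le, Real.log_sqrt (by positivity),
      Real.log_mul hL0.ne' hN0.ne', hlog1, hlogT]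
    linarith
  -- m4
  have f4 : M * N * Real.sqrt b / (L * b) ≤ 1 * TGT := by
    refine step (by positivity) one_pos ?_
    rw [Real.log_div (by positivity) (by positivity), Real.log_mul (by positivity) hsb0,
      Real.log_mul hM0.ne' hN0.ne', Real.log_sqrt hb0.le, Real.log_mul hL0.ne' hb0.ne',
      hlog1, hlogT]
    linarith
  -- m6
  have f6 : M * N * Real.sqrt L / L ≤ 1 * TGT := by
    refine step (by positivity) one_pos ?_
    rw [Real.log_div (by positivity) hL0.ne', Real.log_mul (by positivity) hsL0,
      Real.log_mul hM0.ne' hN0.ne', Real.log_sqrt hL0.le, hlog1, hlogT]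
    linarith
  -- m7
  have f7 : M * N / Real.sqrt M ≤ 1 * TGT := by
    refine step (by positivity) one_pos ?_
    rw [Real.log_div (by positivity) hsM0, Real.log_mul hM0.ne' hN0.ne', Real.log_sqrt hM0.le,
      hlog1, hlogT]
    linarith
  -- m8
  have f8 : L * N * Real.sqrt N * Real.sqrt b / b ≤ 8 * TGT := by
    refine step (by positivity) (by norm_num) ?_
    rw [Real.log_div (by positivity) hb0.ne', Real.log_mul (by positivity) hsb0,
      Real.log_mul (by positivity) hsN0, Real.log_mul hL0.ne' hN0.ne', Real.log_sqrt hN0.le,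
      Real.log_sqrt hb0.le, hlogT]
    rcases hcase with h | h <;> linarith
  -- m9
  have f9 : L * Real.sqrt L * N * Real.sqrt N * Real.sqrt (Real.sqrt (8 * (N / b))) *
      Real.sqrt b / b ≤ 64 * TGT := by
    refine step (by positivity) (by norm_num) ?_
    have h64 : Real.log 64 = 2 * Real.log 8 := by
      rw [show (64 : ℝ) = 8 ^ 2 by norm_num, Real.log_pow]; push_cast; ring
    rw [Real.log_div (by positivity) hb0.ne', Real.log_mul (by positivity) hsb0,
      Real.log_mul (by positivity) (by positivity), Real.log_mul (by positivity) hsN0,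
      Real.log_mul (by positivity) hN0.ne', Real.log_mul hL0.ne' hsL0, Real.log_sqrt hL0.le,
      Real.log_sqrt hN0.le, Real.log_sqrt (Real.sqrt_nonneg _), Real.log_sqrt (by positivity),
      Real.log_mul (by norm_num) (by positivity), Real.log_div hN0.ne' hb0.ne',
      Real.log_sqrt hb0.le, h64, hlogT]
    rcases hcase with h | h <;> linarith
  -- sum
  have : 96 * (M ^ 2 * Real.sqrt b / L) + 256 * (M ^ 2 * Real.sqrt b / (N * L ^ 2)) +
      512 * (M * Real.sqrt b * Real.sqrt (L * N) / L) + 320 * (M * N * Real.sqrt b / (L * b)) +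
      256 * (M * N * Real.sqrt L / L) + 192 * (M * N / Real.sqrt M) +
      7584 * (L * N * Real.sqrt N * Real.sqrt b / b) +
      2528 * (L * Real.sqrt L * N * Real.sqrt N * Real.sqrt (Real.sqrt (8 * (N / b))) *
        Real.sqrt b / b) ≤ (96 + 256 + 512 + 320 + 256 + 192 + 7584 * 8 + 2528 * 64) * TGT := by
    linarith
  refine this.trans ?_
  rw [hTGT]
  norm_num
  nlinarith [hTGT0]

end Literature.NumberTheory.LFunctions

end
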